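import Mathlib
import Summits.Langlands.Langlands.Theorems.PhantomRMYoshidaResiduallyYoshidaLiftingTraceLimit
import Summits.Langlands.Langlands.Theorems.PhantomRMYoshidaResiduallyYoshidaLiftingTraceLimitEndo
import Summits.Langlands.Langlands.Theorems.PhantomRMYoshidaResiduallyYoshidaLiftingTraceLimitIdempotent
import Summits.Langlands.Langlands.Theorems.PhantomRMYoshidaResiduallyYoshidaLiftingTraceLimitResidual
import Summits.Langlands.Langlands.Theorems.PhantomRMYoshidaResiduallyYoshidaLiftingTraceLimitComplete
import Summits.Langlands.Langlands.Theorems.PhantomRMYoshidaResiduallyYoshidaLiftingTraceLimitPseudo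
import Summits.Langlands.Langlands.Theorems.PhantomRMYoshidaResiduallyYoshidaLiftingTraceLimitIntegralModel
import Summits.Langlands.Langlands.Theorems.PhantomRMYoshidaResiduallyYoshidaLiftingResidualCharpoly
import Summits.Langlands.Langlands.Theorems.PhantomRMYoshidaResiduallyYoshidaLiftingResidualSplitting
import Literature.NumberTheory.GaloisRepresentations.StableLatticeValuationRing

/-!
# Trace limits VIII — ENDO-REMOVAL for Stub 4 of line `endoscopic-crossing-euler` (route
# `PhantomRMYoshida`, crux `ResiduallyYoshidaLifting` = stmt-Langlands-13639)

Final assembly of the trace-limit packages I–VII (`--supports stmt-Langlands-13639`).  Stub 4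
`stub_weightTwoClassicality` assumes an irreducible `ρ : Γ_ℚ → GL₄(ℚ̄_p)` at a residually Yoshida point
(`σ̄ ⊕ σ̄'`, `σ̄ ≇ σ̄'` irreducible, a.e. factorisation of the Frobenius polynomials) whose trace is, to
every precision `p⁻ⁿ`, uniformly close to the trace of an AUTOMORPHIC-OR-ENDOSCOPIC approximant.
`false_of_endo_approximants` shows that endoscopic approximants to every precision are impossible,
and `aut_approximants` (registered as `stub_endoRemoval`) concludes: **automorphic approximants exist
at every precision** — unconditionally, for every odd or even `p`.  What remains of Stub 4 after this
file is classicality of `p`-adic limits of AUTOMORPHIC ordinary traces in weight `(2,2)`.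

Proof of `false_of_endo_approximants` (`tr r'_n = tr a_n + tr d_n`, `‖tr r'_n - tr ρ‖_∞ ≤ p⁻ⁿ`):
1. integral models `A_n, D_n, R` of `a_n, d_n, ρ` over `ℤ̄_p` (tree
   `exists_integralModel_of_valuationSubring`);
2. for `n ≥ n₀`: `det(X - A_n) det(X - D_n) ≡ det(X - R)` coefficientwise to precision `< 1` (Newton
   with loss, I; endoscopic charpoly identity, II), hence after reduction
   `det(X - Ā_n) det(X - D̄_n) = det(X - σ̄) det(X - σ̄')` (landed `stub_residualCharpoly` for `R`);
3. residual matching (VI): `Ā_n`, `D̄_n` irreducible, non-equivalent, of types `{σ̄, σ̄'}`; let `b_n` be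
   the block of type `σ̄`, `e_n` the other;
4. rigidity (IV–V): `‖tr b_n - tr b_{n'}‖_∞ ≤ p⁻ⁿ` for `n₀ ≤ n ≤ n'` (Jacobson density over the residue
   field of `ℤ̄_p`, descent of irreducibility/non-equivalence/conjugacy from `k`, VI);
5. limits in `ℂ_p` (VII): `tr b_n → t`, `tr e_n → tr ρ - t` uniformly; both are continuous
   pseudocharacters of dimension `2`, hence traces of continuous `r₁, r₂ : Γ_ℚ → GL₂(ℂ_p)` (Taylor);
6. `tr ρ_{ℂ_p} = tr r₁ + tr r₂` makes `ρ_{ℂ_p}` reducible (II), while `ρ` irreducible over the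
   algebraically closed `ℚ̄_p` stays irreducible over `ℂ_p` (Burnside, VII): contradiction.
-/

noncomputable section

open Filter Topology
open scoped Matrix

namespace Summit.Langlands.Langlands.Cruxes.ResiduallyYoshidaLifting.EndoscopicCrossingEuler

set_option linter.dupNamespace false

open Literature.NumberTheory.GaloisRepresentations Literature.RepresentationTheory.Semisimple


variable {p : ℕ} [Fact p.Prime]

/-! ### Small tools -/

/-- Equivalent irreducible matrix representations over one field are conjugate
(`exists_conj_of_equiv_map` along the identity). [folklore] -/
theorem exists_conj_of_equiv {K : Type} [Field K] {Γ : Type} [Group Γ] {n : ℕ} (φ φ' : Γ →* GL (Fin n) K)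
    (hφ : Representation.IsIrreducible (MonoidHom.comp (Representation.ofDistribMulAction K (GL (Fin n) K) (Fin n → K)) (φ))) (hφ' : Representation.IsIrreducible (MonoidHom.comp (Representation.ofDistribMulAction K (GL (Fin n) K) (Fin n → K)) (φ')))
    (h : Nonempty (Representation.Equiv (MonoidHom.comp (Representation.ofDistribMulAction K (GL (Fin n) K) (Fin n → K)) (φ)) (MonoidHom.comp (Representation.ofDistribMulAction K (GL (Fin n) K) (Fin n → K)) (φ')))) :
    ∃ P : GL (Fin n) K, ∀ g, ((φ' g : GL (Fin n) K) : Matrix (Fin n) (Fin n) K) =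
      (P : Matrix (Fin n) (Fin n) K) * (φ g : GL (Fin n) K) * ((P⁻¹ : GL (Fin n) K) : Matrix (Fin n) (Fin n) K) := by
  refine exists_conj_of_equiv_map (RingHom.id K) φ φ' hφ hφ' ?_
  rw [Matrix.GeneralLinearGroup.map_id, MonoidHom.id_comp, MonoidHom.id_comp]
  exact h

/-- Non-conjugate `σ, σ'` (the crux's hypothesis) are not equivalent on `k²`. [folklore] -/
theorem isEmpty_equiv_of_not_conj {k : Type} [Field k] {Γ : Type} [Group Γ] (σ σ' : Γ →* GL (Fin 2) k)
    (hσ : Representation.IsIrreducible (MonoidHom.comp (Representation.ofDistribMulAction k (GL (Fin 2) k) (Fin 2 → k)) (σ))) (hσ' : Representation.IsIrreducible (MonoidHom.comp (Representation.ofDistribMulAction k (GL (Fin 2) k) (Fin 2 → k)) (σ')))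
    (hnc : ¬ ∃ g : GL (Fin 2) k, ∀ x, g * σ x * g⁻¹ = σ' x) :
    IsEmpty (Representation.Equiv (MonoidHom.comp (Representation.ofDistribMulAction k (GL (Fin 2) k) (Fin 2 → k)) (σ)) (MonoidHom.comp (Representation.ofDistribMulAction k (GL (Fin 2) k) (Fin 2 → k)) (σ'))) := by
  refine ⟨fun E => hnc ?_⟩
  obtain ⟨P, hP⟩ := exists_conj_of_equiv σ σ' hσ hσ' ⟨E⟩
  refine ⟨P, fun x => Units.ext ?_⟩
  rw [Units.val_mul, Units.val_mul, hP x]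

/-! ### Endoscopic approximants to every precision are impossible -/

set_option maxHeartbeats 800000 in
/-- **No endoscopic limit at a residually multiplicity-free point.**  Let `ρ : Γ_ℚ → GL₄(ℚ̄_p)` be
irreducible, `σ, σ' : Γ_ℚ → GL₂(k)` irreducible and non-conjugate (`k` algebraically closed of
characteristic `p`, `red : ℤ̄_p → k`), with the crux's almost-everywhere factorisation
`det(X - ρ(Frob_v)) ≡ det(X - σ(Frob_v)) det(X - σ'(Frob_v))`.  Then `tr ρ` is NOT a uniform `p`-adic
limit of endoscopic traces: there is no sequence of continuous `r'_n` with `tr r'_n = tr a_n + tr d_n`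
(`a_n, d_n : Γ_ℚ → GL₂(ℚ̄_p)` continuous) and `‖tr r'_n - tr ρ‖_∞ ≤ p⁻ⁿ` for all `n`.  Proof: module
docstring (integral models; residual matching; rigidity of the `σ`-typed components; limits in `ℂ_p`;
Taylor; Brauer–Nesbitt against the irreducibility of `ρ_{ℂ_p}`). [folklore] -/
theorem false_of_endo_approximants {k : Type} [Field k] [CharP k p] [IsAlgClosed k] [TopologicalSpace k]
    [DiscreteTopology k] (red : Valued.integer (PadicAlgCl p) →+* k) (σ σ' : FramedGaloisRep ℚ k 2)
    (ρ : FramedGaloisRep ℚ (PadicAlgCl p) 4)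
    (hσ : σ.toGaloisRep.IsIrreducible) (hσ' : σ'.toGaloisRep.IsIrreducible)
    (hnc : ¬ ∃ g : GL (Fin 2) k, ∀ x, g * σ x * g⁻¹ = σ' x)
    (hρ : ρ.toGaloisRep.IsIrreducible)
    (hae : ∀ᶠ v : IsDedekindDomain.HeightOneSpectrum (NumberField.RingOfIntegers ℚ) in Filter.cofinite,
      ρ.IsUnramifiedAt v ∧ σ.IsUnramifiedAt v ∧ σ'.IsUnramifiedAt v ∧
      ∃ (P : Polynomial (Valued.integer (PadicAlgCl p))) (P₁ P₂ : Polynomial k),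
        ρ.HasFrobCharpolyAt v (P.map (Valued.integer (PadicAlgCl p)).subtype) ∧
        σ.HasFrobCharpolyAt v P₁ ∧ σ'.HasFrobCharpolyAt v P₂ ∧ P.map red = P₁ * P₂)
    (hE : ∀ n : ℕ, ∃ r' : FramedGaloisRep ℚ (PadicAlgCl p) 4,
      (∃ r₁ r₂ : FramedGaloisRep ℚ (PadicAlgCl p) 2,
        ∀ g, (r' g).val.trace = (r₁ g).val.trace + (r₂ g).val.trace) ∧
      ∀ g, ‖(r' g).val.trace - (ρ g).val.trace‖ ≤ (p : ℝ) ^ (-(n : ℤ))) : False := by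
  classical
  -- (0) the data
  choose r' hr' using hE
  choose r₁ r₂ hsum using fun n => (hr' n).1
  have hclose : ∀ (n : ℕ) (g : Field.absoluteGaloisGroup ℚ),
      ‖(r' n g).val.trace - (ρ g).val.trace‖ ≤ (p : ℝ) ^ (-(n : ℤ)) := fun n => (hr' n).2
  -- (1) integral models of `r₁ n`, `r₂ n`, `ρ`
  have him2 : ∀ s : FramedGaloisRep ℚ (PadicAlgCl p) 2, ∃ (P : GL (Fin 2) (PadicAlgCl p))
      (A : Field.absoluteGaloisGroup ℚ →* GL (Fin 2) (Valued.integer (PadicAlgCl p))),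
      ∀ g, Matrix.GeneralLinearGroup.map (Valued.integer (PadicAlgCl p)).subtype (A g) = P⁻¹ * s g * P :=
    fun s => exists_integralModel_of_valuationSubring (Valued.isOpen_valuationSubring (PadicAlgCl p)) s
  choose PA A hA using fun n => him2 (r₁ n)
  choose PD D hD using fun n => him2 (r₂ n)
  obtain ⟨PR, R, hR⟩ : ∃ (P : GL (Fin 4) (PadicAlgCl p))
      (R : Field.absoluteGaloisGroup ℚ →* GL (Fin 4) (Valued.integer (PadicAlgCl p))),
      ∀ g, Matrix.GeneralLinearGroup.map (Valued.integer (PadicAlgCl p)).subtype (R g) = P⁻¹ * ρ g * P :=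
    exists_integralModel_of_valuationSubring (Valued.isOpen_valuationSubring (PadicAlgCl p)) ρ
  -- (2) the residual product identity for `n ≥ n₀`
  have hRred : ∀ g, ((R g).val.charpoly).map red = (σ g).val.charpoly * (σ' g).val.charpoly :=
    stub_residualCharpoly p k red σ σ' ρ PR R hR hae
  obtain ⟨n₀, hn₀⟩ : ∃ n₀ : ℕ, ∀ n ≥ n₀,
      ‖(((4 : ℕ).factorial : ℕ) : PadicAlgCl p)‖⁻¹ * (p : ℝ) ^ (-(n : ℤ)) < 1 := by
    have ht : Tendsto (fun n : ℕ => ‖(((4 : ℕ).factorial : ℕ) : PadicAlgCl p)‖⁻¹ * (p : ℝ) ^ (-(n : ℤ)))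
        atTop (𝓝 0) := by
      simpa using tendsto_const_nhds.mul (tendsto_zpow_neg_natCast_nhds_zero (p := p))
    exact eventually_atTop.mp (ht.eventually (gt_mem_nhds one_pos))
  have hres : ∀ n ≥ n₀, ∀ g,
      (((Matrix.GeneralLinearGroup.map red).comp (A n) g).val.charpoly) *
        (((Matrix.GeneralLinearGroup.map red).comp (D n) g).val.charpoly) =
      (σ g).val.charpoly * (σ' g).val.charpoly := by
    intro n hn g
    have hF : ((A n g).val.charpoly * (D n g).val.charpoly).map red = ((R g).val.charpoly).map red := by
      refine map_red_eq_of_norm_coeff_sub_lt_one red _ _ fun i => ?_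
      rw [Polynomial.map_mul, map_charpoly_of_integralModel (hA n), map_charpoly_of_integralModel (hD n),
        map_charpoly_of_integralModel hR, ← charpoly_eq_mul_of_endo (r' n) (r₁ n) (r₂ n) (hsum n) g]
      exact (stub_traceLimitCharpoly p 4 ρ (r' n) _ (hclose n) g i).trans_lt (hn₀ n hn)
    rw [MonoidHom.comp_apply, MonoidHom.comp_apply]
    change ((A n g).val.map red).charpoly * ((D n g).val.map red).charpoly = _
    rw [Matrix.charpoly_map, Matrix.charpoly_map, ← Polynomial.map_mul, hF, hRred]
  -- (3) residual matching; the `σ`-typed block `b n` and the other block `e n`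
  have hσi : Representation.IsIrreducible (MonoidHom.comp (Representation.ofDistribMulAction k (GL (Fin 2) k) (Fin 2 → k)) (σ.toMonoidHom)) := hσ
  have hσ'i : Representation.IsIrreducible (MonoidHom.comp (Representation.ofDistribMulAction k (GL (Fin 2) k) (Fin 2 → k)) (σ'.toMonoidHom)) := hσ'
  have hne : IsEmpty (Representation.Equiv (MonoidHom.comp (Representation.ofDistribMulAction k (GL (Fin 2) k) (Fin 2 → k)) (σ.toMonoidHom)) (MonoidHom.comp (Representation.ofDistribMulAction k (GL (Fin 2) k) (Fin 2 → k)) (σ'.toMonoidHom))) :=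
    isEmpty_equiv_of_not_conj σ.toMonoidHom σ'.toMonoidHom hσi hσ'i hnc
  have hM := fun n (hn : n₀ ≤ n) =>
    matching_of_charpoly_mul ((Matrix.GeneralLinearGroup.map red).comp (A n))
      ((Matrix.GeneralLinearGroup.map red).comp (D n)) σ.toMonoidHom σ'.toMonoidHom hσi hσ'i hne (hres n hn)
  let typ : ℕ → Prop := fun n =>
    Nonempty (Representation.Equiv (MonoidHom.comp (Representation.ofDistribMulAction k (GL (Fin 2) k) (Fin 2 → k)) ((Matrix.GeneralLinearGroup.map red).comp (A n))) (MonoidHom.comp (Representation.ofDistribMulAction k (GL (Fin 2) k) (Fin 2 → k)) (σ.toMonoidHom)))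
  let b : ℕ → (Field.absoluteGaloisGroup ℚ →* GL (Fin 2) (Valued.integer (PadicAlgCl p))) :=
    fun n => if typ n then A n else D n
  let e : ℕ → (Field.absoluteGaloisGroup ℚ →* GL (Fin 2) (Valued.integer (PadicAlgCl p))) :=
    fun n => if typ n then D n else A n
  have hbA : ∀ n, typ n → b n = A n := fun n h => by simp only [b]; exact if_pos h
  have heD : ∀ n, typ n → e n = D n := fun n h => by simp only [e]; exact if_pos h
  have hbD : ∀ n, ¬ typ n → b n = D n := fun n h => by simp only [b]; exact if_neg h
  have heA : ∀ n, ¬ typ n → e n = A n := fun n h => by simp only [e]; exact if_neg h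
  have hb : ∀ n ≥ n₀,
      Representation.IsIrreducible (MonoidHom.comp (Representation.ofDistribMulAction k (GL (Fin 2) k) (Fin 2 → k)) ((Matrix.GeneralLinearGroup.map red).comp (b n))) ∧
      Representation.IsIrreducible (MonoidHom.comp (Representation.ofDistribMulAction k (GL (Fin 2) k) (Fin 2 → k)) ((Matrix.GeneralLinearGroup.map red).comp (e n))) ∧
      IsEmpty (Representation.Equiv (MonoidHom.comp (Representation.ofDistribMulAction k (GL (Fin 2) k) (Fin 2 → k)) ((Matrix.GeneralLinearGroup.map red).comp (b n)))
        (MonoidHom.comp (Representation.ofDistribMulAction k (GL (Fin 2) k) (Fin 2 → k)) ((Matrix.GeneralLinearGroup.map red).comp (e n)))) ∧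
      Nonempty (Representation.Equiv (MonoidHom.comp (Representation.ofDistribMulAction k (GL (Fin 2) k) (Fin 2 → k)) ((Matrix.GeneralLinearGroup.map red).comp (b n)))
        (MonoidHom.comp (Representation.ofDistribMulAction k (GL (Fin 2) k) (Fin 2 → k)) (σ.toMonoidHom))) ∧
      Nonempty (Representation.Equiv (MonoidHom.comp (Representation.ofDistribMulAction k (GL (Fin 2) k) (Fin 2 → k)) ((Matrix.GeneralLinearGroup.map red).comp (e n)))
        (MonoidHom.comp (Representation.ofDistribMulAction k (GL (Fin 2) k) (Fin 2 → k)) (σ'.toMonoidHom))) := by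
    intro n hn
    obtain ⟨hAi, hDi, hADe, hmatch⟩ := hM n hn
    by_cases ht : typ n
    · rw [hbA n ht, heD n ht]
      refine ⟨hAi, hDi, hADe, ht, ?_⟩
      rcases hmatch with ⟨-, hD'⟩ | ⟨hA', -⟩
      · exact hD'
      · obtain ⟨E1⟩ := ht
        obtain ⟨E2⟩ := hA'
        exact (hne.false (E1.symm.trans E2)).elim
    · rw [hbD n ht, heA n ht]
      rcases hmatch with ⟨hA', -⟩ | ⟨hA', hD'⟩
      · exact (ht hA').elim
      · exact ⟨hDi, hAi, ⟨fun E => hADe.false E.symm⟩, hD', hA'⟩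
  have htr : ∀ (n : ℕ) (g : Field.absoluteGaloisGroup ℚ),
      ((((b n g : GL (Fin 2) (Valued.integer (PadicAlgCl p))) : Matrix (Fin 2) (Fin 2) _).trace :
          Valued.integer (PadicAlgCl p)) : PadicAlgCl p) +
        ((((e n g : GL (Fin 2) (Valued.integer (PadicAlgCl p))) : Matrix (Fin 2) (Fin 2) _).trace :
          Valued.integer (PadicAlgCl p)) : PadicAlgCl p) = (r' n g).val.trace := by
    intro n g
    by_cases ht : typ n
    · rw [hbA n ht, heD n ht, coe_trace_of_integralModel (hA n), coe_trace_of_integralModel (hD n), hsum n g]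
    · rw [hbD n ht, heA n ht, coe_trace_of_integralModel (hD n), coe_trace_of_integralModel (hA n), hsum n g,
        add_comm]
  -- (4) rigidity of the `σ`-typed blocks: `‖tr b_n - tr b_{n'}‖ ≤ p⁻ⁿ` for `n₀ ≤ n ≤ n'`
  obtain ⟨f, hf⟩ := exists_residueField_factor red
  have hfred : (Matrix.GeneralLinearGroup.map (n := Fin 2) f).comp
      (Matrix.GeneralLinearGroup.map (IsLocalRing.residue (Valued.integer (PadicAlgCl p)))) =
      Matrix.GeneralLinearGroup.map red := by
    rw [← Matrix.GeneralLinearGroup.map_comp]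
    congr 1
    exact RingHom.ext hf
  have hlift : ∀ X : Field.absoluteGaloisGroup ℚ →* GL (Fin 2) (Valued.integer (PadicAlgCl p)),
      (Matrix.GeneralLinearGroup.map f).comp
        ((Matrix.GeneralLinearGroup.map (IsLocalRing.residue (Valued.integer (PadicAlgCl p)))).comp X) =
      (Matrix.GeneralLinearGroup.map red).comp X := fun X => by
    rw [← MonoidHom.comp_assoc, hfred]
  have nsub : ∀ a c : PadicAlgCl p, ‖a - c‖ ≤ max ‖a‖ ‖c‖ := fun a c => by
    simpa [sub_eq_add_neg, norm_neg] using IsUltrametricDist.norm_add_le_max a (-c)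
  have hrig : ∀ (n n' : ℕ), n₀ ≤ n → n ≤ n' → ∀ g : Field.absoluteGaloisGroup ℚ,
      ‖((((b n g : GL (Fin 2) (Valued.integer (PadicAlgCl p))) : Matrix (Fin 2) (Fin 2) _).trace :
          Valued.integer (PadicAlgCl p)) : PadicAlgCl p) -
        ((((b n' g : GL (Fin 2) (Valued.integer (PadicAlgCl p))) : Matrix (Fin 2) (Fin 2) _).trace :
          Valued.integer (PadicAlgCl p)) : PadicAlgCl p)‖ ≤ (p : ℝ) ^ (-(n : ℤ)) := by
    intro n n' hn hnn' g
    obtain ⟨hbi, hei, hbe, ⟨Eb⟩, ⟨Ee⟩⟩ := hb n hn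
    obtain ⟨hbi', hei', -, ⟨Eb'⟩, ⟨Ee'⟩⟩ := hb n' (hn.trans hnn')
    have irrκ : ∀ X : Field.absoluteGaloisGroup ℚ →* GL (Fin 2) (Valued.integer (PadicAlgCl p)),
        Representation.IsIrreducible (MonoidHom.comp (Representation.ofDistribMulAction k (GL (Fin 2) k) (Fin 2 → k)) ((Matrix.GeneralLinearGroup.map red).comp X)) →
        Representation.IsIrreducible
          (MonoidHom.comp (Representation.ofDistribMulAction (IsLocalRing.ResidueField (Valued.integer (PadicAlgCl p))) (GL (Fin 2) (IsLocalRing.ResidueField (Valued.integer (PadicAlgCl p)))) (Fin 2 → IsLocalRing.ResidueField (Valued.integer (PadicAlgCl p)))) ((Matrix.GeneralLinearGroup.map (IsLocalRing.residue (Valued.integer (PadicAlgCl p)))).comp X)) :=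
      fun X hX => isIrreducible_of_isIrreducible_map two_pos f _ (by rw [hlift]; exact hX)
    refine norm_trace_sub_trace_le_of_residuallyConj (b n) (b n') (e n) (e n') (ε := (p : ℝ) ^ (-(n : ℤ)))
      (fun g => ?_) (irrκ _ hbi) (irrκ _ hei) ?_ ?_ ?_ g
    · rw [htr n g, htr n' g]
      have hdec : (r' n g).val.trace - (r' n' g).val.trace =
          ((r' n g).val.trace - (ρ g).val.trace) - ((r' n' g).val.trace - (ρ g).val.trace) := by ring
      rw [hdec]
      refine (nsub _ _).trans (max_le (hclose n g) ((hclose n' g).trans ?_))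
      exact zpow_le_zpow_right₀ (by exact_mod_cast (Fact.out : p.Prime).one_lt.le)
        (neg_le_neg (by exact_mod_cast hnn'))
    · exact isEmpty_equiv_of_isEmpty_equiv_map f _ _ (by rw [hlift]; exact hbi) (by rw [hlift]; exact hei)
        (by rw [hlift, hlift]; exact hbe)
    · exact exists_conj_of_equiv_map f _ _ (irrκ _ hbi) (irrκ _ hbi')
        (by rw [hlift, hlift]; exact ⟨Eb.trans Eb'.symm⟩)
    · exact exists_conj_of_equiv_map f _ _ (irrκ _ hei) (irrκ _ hei')
        (by rw [hlift, hlift]; exact ⟨Ee.trans Ee'.symm⟩)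
  -- (5) the limit `t` of the `σ`-typed traces in `ℂ_p`
  set x : ℕ → Field.absoluteGaloisGroup ℚ → PadicAlgCl p := fun m g =>
    ((((b (n₀ + m) g : GL (Fin 2) (Valued.integer (PadicAlgCl p))) : Matrix (Fin 2) (Fin 2) _).trace :
      Valued.integer (PadicAlgCl p)) : PadicAlgCl p) with hxdef
  have hpm : ∀ m : ℕ, (p : ℝ) ^ (-((n₀ + m : ℕ) : ℤ)) ≤ (p : ℝ) ^ (-(m : ℤ)) := fun m =>
    zpow_le_zpow_right₀ (by exact_mod_cast (Fact.out : p.Prime).one_lt.le)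
      (neg_le_neg (by exact_mod_cast Nat.le_add_left m n₀))
  have hx : ∀ (m m' : ℕ), m ≤ m' → ∀ g, ‖x m g - x m' g‖ ≤ (p : ℝ) ^ (-(m : ℤ)) :=
    fun m m' hmm' g => (hrig (n₀ + m) (n₀ + m') (Nat.le_add_right n₀ m) (Nat.add_le_add_left hmm' n₀) g).trans
      (hpm m)
  obtain ⟨t, ht⟩ := exists_limit_padicComplex x hx
  -- (6) Taylor in `ℂ_p`: `t` and `tr ρ - t` are traces of continuous representations
  have hps : ∀ (m : ℕ) (X : Field.absoluteGaloisGroup ℚ →* GL (Fin 2) (Valued.integer (PadicAlgCl p))),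
      IsPseudocharacter (fun g => (((((X g : GL (Fin 2) (Valued.integer (PadicAlgCl p))) :
        Matrix (Fin 2) (Fin 2) _).trace : Valued.integer (PadicAlgCl p)) : PadicAlgCl p) : ℂ_[p])) 2 :=
    fun m X => (Rouquier1996_prop_3_1_trace_holds (Field.absoluteGaloisGroup ℚ) (Valued.integer (PadicAlgCl p)) 2
      X).map ((algebraMap (PadicAlgCl p) ℂ_[p]).comp (Valued.integer (PadicAlgCl p)).subtype)
  have hcontr : ∀ (s : FramedGaloisRep ℚ (PadicAlgCl p) 2),
      Continuous fun g => (((s g).val.trace : PadicAlgCl p) : ℂ_[p]) := fun s =>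
    (continuous_algebraMap (PadicAlgCl p) ℂ_[p]).comp s.continuous_trace
  have hcont4 : ∀ (s : FramedGaloisRep ℚ (PadicAlgCl p) 4),
      Continuous fun g => (((s g).val.trace : PadicAlgCl p) : ℂ_[p]) := fun s =>
    (continuous_algebraMap (PadicAlgCl p) ℂ_[p]).comp s.continuous_trace
  have hxcont : ∀ m, Continuous fun g => ((x m g : PadicAlgCl p) : ℂ_[p]) := by
    intro m
    by_cases htm : typ (n₀ + m)
    · have : (fun g => ((x m g : PadicAlgCl p) : ℂ_[p])) = fun g => (((r₁ (n₀ + m) g).val.trace : PadicAlgCl p) : ℂ_[p]) := by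
        funext g
        rw [hxdef]
        simp only
        rw [hbA _ htm, coe_trace_of_integralModel (hA (n₀ + m))]
      rw [this]; exact hcontr _
    · have : (fun g => ((x m g : PadicAlgCl p) : ℂ_[p])) = fun g => (((r₂ (n₀ + m) g).val.trace : PadicAlgCl p) : ℂ_[p]) := by
        funext g
        rw [hxdef]
        simp only
        rw [hbD _ htm, coe_trace_of_integralModel (hD (n₀ + m))]
      rw [this]; exact hcontr _
  obtain ⟨s₁, hs₁⟩ := exists_framedRep_of_uniform_limit_of_isPseudocharacter (A := ℂ_[p]) (p := p)
    (fun m g => ((x m g : PadicAlgCl p) : ℂ_[p])) t (fun m => hps m (b (n₀ + m))) hxcont ht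
  -- the other component
  set y : ℕ → Field.absoluteGaloisGroup ℚ → ℂ_[p] := fun m g =>
    (((r' (n₀ + m) g).val.trace : PadicAlgCl p) : ℂ_[p]) - ((x m g : PadicAlgCl p) : ℂ_[p]) with hydef
  have hy_eq : ∀ m, y m = fun g => (((((e (n₀ + m) g : GL (Fin 2) (Valued.integer (PadicAlgCl p))) :
      Matrix (Fin 2) (Fin 2) _).trace : Valued.integer (PadicAlgCl p)) : PadicAlgCl p) : ℂ_[p]) := by
    intro m
    funext g
    rw [hydef, hxdef]
    simp only
    rw [← htr (n₀ + m) g, UniformSpace.Completion.coe_add, add_sub_cancel_left]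
  have nsubC : ∀ a c : ℂ_[p], ‖a - c‖ ≤ max ‖a‖ ‖c‖ := fun a c => by
    simpa [sub_eq_add_neg, norm_neg] using IsUltrametricDist.norm_add_le_max a (-c)
  have hyt : ∀ (m : ℕ) (g : Field.absoluteGaloisGroup ℚ),
      ‖y m g - ((((ρ g).val.trace : PadicAlgCl p) : ℂ_[p]) - t g)‖ ≤ (p : ℝ) ^ (-(m : ℤ)) := by
    intro m g
    have hdec : y m g - ((((ρ g).val.trace : PadicAlgCl p) : ℂ_[p]) - t g) =
        ((((r' (n₀ + m) g).val.trace : PadicAlgCl p) : ℂ_[p]) - (((ρ g).val.trace : PadicAlgCl p) : ℂ_[p])) -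
          (((x m g : PadicAlgCl p) : ℂ_[p]) - t g) := by
      rw [hydef]; ring
    rw [hdec]
    refine (nsubC _ _).trans (max_le ?_ (ht m g))
    rw [← UniformSpace.Completion.coe_sub, PadicComplex.norm_extends]
    exact (hclose (n₀ + m) g).trans (hpm m)
  have hycont : ∀ m, Continuous (y m) := fun m => (hcont4 (r' (n₀ + m))).sub (hxcont m)
  obtain ⟨s₂, hs₂⟩ := exists_framedRep_of_uniform_limit_of_isPseudocharacter (A := ℂ_[p]) (p := p) y
    (fun g => (((ρ g).val.trace : PadicAlgCl p) : ℂ_[p]) - t g)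
    (fun m => by rw [hy_eq m]; exact hps m (e (n₀ + m))) hycont hyt
  -- (7) `ρ ⊗ ℂ_p` is endoscopic, hence reducible; but it is irreducible
  let ρC : FramedRep (Field.absoluteGaloisGroup ℚ) ℂ_[p] 4 :=
    ρ.baseChange (algebraMap (PadicAlgCl p) ℂ_[p]) (continuous_algebraMap (PadicAlgCl p) ℂ_[p])
  have htrC : ∀ g, (ρC g).val.trace = (((ρ g).val.trace : PadicAlgCl p) : ℂ_[p]) := fun g => by
    change (((ρ g).val).map (algebraMap (PadicAlgCl p) ℂ_[p])).trace = _
    rw [← AddMonoidHom.map_trace]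
    rfl
  have hsumC : ∀ g, (ρC g).val.trace = (s₁ g).val.trace + (s₂ g).val.trace := fun g => by
    rw [htrC, hs₁ g, hs₂ g]; ring
  have hnot := not_isIrreducible_of_trace_eq_add (K := ℂ_[p]) (n := 4) (a := 2) (b := 2) finSumFinEquiv
    two_pos two_pos ρC.toMonoidHom s₁.toMonoidHom s₂.toMonoidHom hsumC
  have h4 : Representation.IsIrreducible (MonoidHom.comp (Representation.ofDistribMulAction (PadicAlgCl p) (GL (Fin 4) (PadicAlgCl p)) (Fin 4 → PadicAlgCl p)) (ρ.toMonoidHom)) := hρ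
  exact hnot (isIrreducible_map_of_isIrreducible (by norm_num) (algebraMap (PadicAlgCl p) ℂ_[p]) ρ.toMonoidHom h4)

/-! ### Endo-removal: automorphic approximants at every precision -/

/-- **Endo-removal for Stub 4 `stub_weightTwoClassicality` (unconditional).**  Under the residual
hypotheses of Stub 4 (`σ, σ'` irreducible non-conjugate, `ρ` irreducible, a.e. factorisation of the
Frobenius polynomials of `ρ` through `red`) and its pro-automorphy hypothesis — for every `n` an
approximant `r'` of `ρ` to trace-precision `p⁻ⁿ` which is automorphic (`Aut r'`, ANY predicate) or
endoscopic, and of type `OrdLevel r'` (ANY predicate) — AUTOMORPHIC approximants exist to every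
precision: by the Aut/Endo dichotomy (`aut_approximants_or_endo_approximants`, II) the alternative is
endoscopic approximants to every precision, excluded by `false_of_endo_approximants`.  Oddness,
determinants, symplecticity and ordinarity of `ρ` are not used.  So Stub 4 is reduced to: a `p`-adic
limit (uniform on `Γ_ℚ`) of traces of AUTOMORPHIC (cuspidal L-algebraic, level-`S`, regular-ordinary,
`GSp`-valued) representations, which is irreducible, symplectic-`ε⁻¹`, Greenberg-`(0,0,1,1)` and
`p`-distinguished, is automorphic — weight-(2,2) classicality proper. [folklore] -/
theorem aut_approximants {k : Type} [Field k] [CharP k p] [IsAlgClosed k] [TopologicalSpace k]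
    [DiscreteTopology k] (red : Valued.integer (PadicAlgCl p) →+* k) (σ σ' : FramedGaloisRep ℚ k 2)
    (Aut OrdLevel : FramedGaloisRep ℚ (PadicAlgCl p) 4 → Prop) (ρ : FramedGaloisRep ℚ (PadicAlgCl p) 4)
    (hσ : σ.toGaloisRep.IsIrreducible) (hσ' : σ'.toGaloisRep.IsIrreducible)
    (hnc : ¬ ∃ g : GL (Fin 2) k, ∀ x, g * σ x * g⁻¹ = σ' x)
    (hρ : ρ.toGaloisRep.IsIrreducible)
    (hae : ∀ᶠ v : IsDedekindDomain.HeightOneSpectrum (NumberField.RingOfIntegers ℚ) in Filter.cofinite,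
      ρ.IsUnramifiedAt v ∧ σ.IsUnramifiedAt v ∧ σ'.IsUnramifiedAt v ∧
      ∃ (P : Polynomial (Valued.integer (PadicAlgCl p))) (P₁ P₂ : Polynomial k),
        ρ.HasFrobCharpolyAt v (P.map (Valued.integer (PadicAlgCl p)).subtype) ∧
        σ.HasFrobCharpolyAt v P₁ ∧ σ'.HasFrobCharpolyAt v P₂ ∧ P.map red = P₁ * P₂)
    (h : ∀ n : ℕ, ∃ r' : FramedGaloisRep ℚ (PadicAlgCl p) 4,
      (Aut r' ∨ ∃ r₁ r₂ : FramedGaloisRep ℚ (PadicAlgCl p) 2,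
          ∀ g, (r' g).val.trace = (r₁ g).val.trace + (r₂ g).val.trace) ∧ OrdLevel r' ∧
        ∀ g, ‖(r' g).val.trace - (ρ g).val.trace‖ ≤ (p : ℝ) ^ (-(n : ℤ))) :
    ∀ n : ℕ, ∃ r' : FramedGaloisRep ℚ (PadicAlgCl p) 4, Aut r' ∧ OrdLevel r' ∧
      ∀ g, ‖(r' g).val.trace - (ρ g).val.trace‖ ≤ (p : ℝ) ^ (-(n : ℤ)) := by
  rcases aut_approximants_or_endo_approximants Aut OrdLevel ρ h with hA | hEo
  · exact hA
  · refine (false_of_endo_approximants red σ σ' ρ hσ hσ' hnc hρ hae fun n => ?_).elim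
    obtain ⟨r', hE, -, hc⟩ := hEo n
    exact ⟨r', hE, hc⟩

/-- **Registered sub-goal `stub_endoRemoval` of Stub 4** (the statement through which this helper
file lands, `--supports stmt-Langlands-13639`; = `aut_approximants` in closed form, binders in the
order of `stub_weightTwoClassicality`). [folklore] -/
theorem stub_endoRemoval :
    ∀ (p : ℕ) [Fact p.Prime] (k : Type) [Field k] [CharP k p] [IsAlgClosed k] [TopologicalSpace k]
      [DiscreteTopology k] (red : Valued.integer (PadicAlgCl p) →+* k)
      (σ σ' : Literature.NumberTheory.GaloisRepresentations.FramedGaloisRep ℚ k 2)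
      (Aut OrdLevel : Literature.NumberTheory.GaloisRepresentations.FramedGaloisRep ℚ (PadicAlgCl p) 4 → Prop)
      (ρ : Literature.NumberTheory.GaloisRepresentations.FramedGaloisRep ℚ (PadicAlgCl p) 4),
      σ.toGaloisRep.IsIrreducible → σ'.toGaloisRep.IsIrreducible →
      (¬ ∃ g : GL (Fin 2) k, ∀ x, g * σ x * g⁻¹ = σ' x) →
      ρ.toGaloisRep.IsIrreducible →
      (∀ᶠ v : IsDedekindDomain.HeightOneSpectrum (NumberField.RingOfIntegers ℚ) in Filter.cofinite,
        ρ.IsUnramifiedAt v ∧ σ.IsUnramifiedAt v ∧ σ'.IsUnramifiedAt v ∧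
        ∃ (P : Polynomial (Valued.integer (PadicAlgCl p))) (P₁ P₂ : Polynomial k),
          ρ.HasFrobCharpolyAt v (P.map (Valued.integer (PadicAlgCl p)).subtype) ∧
          σ.HasFrobCharpolyAt v P₁ ∧ σ'.HasFrobCharpolyAt v P₂ ∧ P.map red = P₁ * P₂) →
      (∀ n : ℕ, ∃ r' : Literature.NumberTheory.GaloisRepresentations.FramedGaloisRep ℚ (PadicAlgCl p) 4,
        (Aut r' ∨ ∃ r₁ r₂ : Literature.NumberTheory.GaloisRepresentations.FramedGaloisRep ℚ (PadicAlgCl p) 2,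
            ∀ g, (r' g).val.trace = (r₁ g).val.trace + (r₂ g).val.trace) ∧ OrdLevel r' ∧
          ∀ g, ‖(r' g).val.trace - (ρ g).val.trace‖ ≤ (p : ℝ) ^ (-(n : ℤ))) →
      ∀ n : ℕ, ∃ r' : Literature.NumberTheory.GaloisRepresentations.FramedGaloisRep ℚ (PadicAlgCl p) 4,
        Aut r' ∧ OrdLevel r' ∧ ∀ g, ‖(r' g).val.trace - (ρ g).val.trace‖ ≤ (p : ℝ) ^ (-(n : ℤ)) :=
  fun _ _ _ _ _ _ _ _ red σ σ' Aut OrdLevel ρ hσ hσ' hnc hρ hae h =>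
    aut_approximants red σ σ' Aut OrdLevel ρ hσ hσ' hnc hρ hae h

end Summit.Langlands.Langlands.Cruxes.ResiduallyYoshidaLifting.EndoscopicCrossingEuler

end
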